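import Literature.NumberTheory.IwasawaTheory.SymmetricThreeTowerExact
import Literature.NumberTheory.IwasawaTheory.ClassicalMuVanishesTransportAlgEquivTwo
import Literature.NumberTheory.IwasawaTheory.ClassicalMuVanishesRealQuadraticTwo
import Literature.NumberTheory.IwasawaTheory.ClassicalMuVanishesCyclicAscentOddRat
import Literature.NumberTheory.IwasawaTheory.ClassicalMuVanishesFiniteDescent
import Mathlib.GroupTheory.SpecificGroups.Cyclic
import Mathlib.GroupTheory.Perm.Cycle.Type
import HarnessLib

set_option autoImplicit false

/-!
# The exact `S₃` relation for an ABSTRACT non-Galois cubic field, its Galois closure and its quadratic resolvent,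
# in the intrinsic cyclotomic currency: `e_n(L) = e_n(k) + 2·e_n(F)`, `μ₂(L) = 0 ⟺ μ₂(F) = 0`, `λ₂(L) = λ₂(k) + 2λ₂(F)`

Topic `NumberTheory/IwasawaTheory` (namespace = path).  THEOREM-ONLY file (no definition, no named fact, no `sorry`), written by the
prover seat `bsd-line-att-p4` g33 (cell `bsd-f1-sign2`, route `AlignedTransportAtTwo`, `--supports` stmt-BirchSwinnertonDyer-22298; closes nothing;
BSD is proved for no curve here).  Sequel of `SymmetricThreeTowerExact.lean` (att-p4 g30/g31): there the exact `2`-part of the Brauer–Kuroda class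
number relation for `S₃` (Walter 1977; Caputo–Nuccio 2020, Prop. 3.12; Bartel 2012, Cor. 5.2) is proved at every layer of the RESTRICTED towers
`κ|_L, κ|_{L^σ}, κ|_{L^τ}, κ|_{L^{σ,τ}}` of ONE `ℤ₂`-extension `κ` of a base field, for a GIVEN `S₃`-pair `σ, τ ∈ Gal(L/F)`, under four
surjectivity binders.  Here the same content is stated the way a number theorist quotes it — for

* an abstract cubic number field `F` which is NOT Galois over `ℚ` (an `S₃`-cubic),
* ANY Galois sextic number field `L` receiving a `ℚ`-embedding `ι : F →ₐ[ℚ] L` (a Galois closure of `F`) with `√2 ∉ L`,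
* ANY quadratic subfield `k ≤ L` (the quadratic resolvent `ℚ(√d_F)`; it is unique, but uniqueness is not needed),
* ANY cyclotomic `ℤ₂`-extensions `κ_L, κ_k, κ_F` of `L`, `k`, `F` (`IsCyclotomic`; no restricted tower, no surjectivity binder, no `ℚ̄`-model):

* §1 (group theory / Galois theory) `exists_symmetricThree_pair_of_not_normal` — in a group of order `6`, a subgroup `C` of order `3` and a
  NON-NORMAL subgroup `H` of order `2` are `⟨σ⟩, ⟨τ⟩` with `σ³ = 1, τ² = 1, τσ = σ²τ, ⟨σ, τ⟩ = G`; `exists_symmetricThree_pair_of_cubic` — for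
  `F, L, ι, k` as above: `σ, τ ∈ Gal(L/ℚ)` with `L^σ = k`, `L^τ = ι(F)`, `L^{σ,τ} = ℚ` (the fixing subgroup of `ι(F)` is not normal BECAUSE `F/ℚ`
  is not Galois); `exists_intermediateField_finrank_eq_two` (a Galois sextic containing a non-Galois cubic has a quadratic subfield).
* §2 ★★ **`classNumberPExp_galoisClosure_eq_resolvent_add_two_mul_cubic`** — `e_n(κ_L) = e_n(κ_k) + 2·e_n(κ_F)` for EVERY `n`
  (`e_n = ord₂ h` of the `n`-th layer): `classNumberPExp_symmetricThree_exact` over the base `ℚ` along the cyclotomic `ℤ₂`-extension of `ℚ`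
  (`L ∩ ℚ_∞ = ℚ` from `√2 ∉ L`), the fixed fields identified with `k`, `F`, `ℚ` by `ℚ`-isomorphisms, `e_n(ℚ) = 0` (Weber–Iwasawa), and
  independence of the chosen cyclotomic `κ`'s.
* §3 ★ **`classicalMuVanishes_galoisClosure_iff_cubic`** — `μ₂(κ_L) = 0 ⟺ μ₂(κ_F) = 0` (growth form), the resolvent input `μ₂(κ_k) = 0`
  DISCHARGED by the tree's theorem for quadratic fields (`classicalMuVanishes_of_finrank_eq_two`, att-p3 g34) and `μ₂(ℚ) = 0` by Weber;
  ★ **`classicalLambda_galoisClosure_eq_resolvent_add_two_mul_cubic`** — `λ₂(κ_L) = λ₂(κ_k) + 2·λ₂(κ_F)` given `μ₂(κ_F) = 0`.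
* §4 the same statements with `[Algebra F L]` in place of `ι`.
Why `√2 ∉ L` (i.e. `2·d_F ∉ ℚ²`, the resolvent is not `ℚ(√2)`; automatic for COMPLEX cubics): otherwise `k = ℚ(√2) = ℚ_1 ⊆ ℚ_∞`,
`Gal(L·ℚ_n/ℚ_n) = C₃` for `n ≥ 1` and `L·ℚ_n = F·ℚ_n` — the `S₃`-structure collapses up the tower.  This is the W-FREE form of att-p4 g30's
`Summits/…/AlignedTransportAtTwoMainConjectureOfRankZeroBSDAtTwoSexticKurodaExact` (`T = ℚ(W[2])`, `k = ℚ(√Δ_W)`, `F = ℚ(β)`).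

References: [CaputoNuccio2020] Prop. 3.12, Thm. 3.14; [Bartel2012] Cor. 5.2; [Walter1979Brauer]; [Washington1997] §13.1, §13.3, Thm. 10.4;
[FerreroWashington1979]; [DavenportHeilbronn1971] §6; tree: `SymmetricThreeTowerExact`, `ClassicalMuVanishesRealQuadraticTwo`, `CubicResolventClosure`.
-/

noncomputable section

open scoped NumberField Classical
open NumberField Field IntermediateField

namespace Literature.NumberTheory.IwasawaTheory

open Literature.NumberTheory.EllipticCurves Literature.NumberTheory.EllipticCurves.ZpExtension
  Literature.NumberTheory.GaloisRepresentations Literature.NumberTheory.NumberFields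

/-! ### §1 The `S₃`-pair of a Galois sextic containing a non-Galois cubic -/

/-- **`S₃` from a non-normal subgroup of order `2`.**  In a group `G` of order `6`, let `C ≤ G` have order `3` and `H ≤ G` order `2` with `H` NOT
normal.  Then `C = ⟨σ⟩`, `H = ⟨τ⟩` with `σ³ = 1`, `τ² = 1`, `τσ = σ²τ` and `⟨σ, τ⟩ = G`.  (`C` has index `2`, so `τστ⁻¹ ∈ C = {1, σ, σ²}`;
`τστ⁻¹ = 1` is absurd and `τστ⁻¹ = σ` would make `G = ⟨σ, τ⟩` centralise `τ`, whence `H ⊴ G`.)  The group-theoretic half of «a group of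
order `6` with a non-normal subgroup is `S₃ = ⟨σ, τ | σ³ = τ² = 1, τσ = σ²τ⟩`». [cite: DummitFoote2004, §4.5 (groups of order pq) and §1.3 (presentation of S₃)]
[cite: Rotman1995, Ch. 4 (groups of order pq)] -/
theorem exists_symmetricThree_pair_of_not_normal {G : Type*} [Group G] [Finite G] (hG : Nat.card G = 6) (C H : Subgroup G)
    (hC : Nat.card C = 3) (hH : Nat.card H = 2) (hHn : ¬ H.Normal) :
    ∃ σ τ : G, Subgroup.zpowers σ = C ∧ Subgroup.zpowers τ = H ∧ σ ^ 3 = 1 ∧ τ ^ 2 = 1 ∧ τ * σ = σ ^ 2 * τ ∧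
      Subgroup.closure ({σ, τ} : Set G) = ⊤ := by
  classical
  -- generators of the two subgroups of prime order
  have gen : ∀ (S : Subgroup G) (q : ℕ), q.Prime → Nat.card S = q → ∃ g : G, Subgroup.zpowers g = S ∧ orderOf g = q := by
    intro S q hq hS
    haveI : Fact q.Prime := ⟨hq⟩
    haveI : IsCyclic S := isCyclic_of_prime_card hS
    obtain ⟨g, hg⟩ := IsCyclic.exists_ofOrder_eq_natCard (α := S)
    have hg' : orderOf (g : G) = q := by rw [Subgroup.orderOf_coe, hg, hS]
    refine ⟨g, Subgroup.eq_of_le_of_card_ge (Subgroup.zpowers_le.mpr g.2) (by rw [Nat.card_zpowers, hg', hS]), hg'⟩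
  obtain ⟨σ, hσC, hoσ⟩ := gen C 3 Nat.prime_three hC
  obtain ⟨τ, hτH, hoτ⟩ := gen H 2 Nat.prime_two hH
  have hσ3 : σ ^ 3 = 1 := by rw [← hoσ]; exact pow_orderOf_eq_one σ
  have hτ2 : τ ^ 2 = 1 := by rw [← hoτ]; exact pow_orderOf_eq_one τ
  have hτinv : τ⁻¹ = τ := inv_eq_of_mul_eq_one_right (by rw [← pow_two]; exact hτ2)
  -- `C` has index `2`; `τ ∉ C`
  have hCi : C.index = 2 := by
    have h := C.card_mul_index; rw [hC, hG] at h; omega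
  have hτC : τ ∉ C := by
    intro h
    have h3 : orderOf τ ∣ 3 := hC ▸ Subgroup.orderOf_dvd_natCard C h
    rw [hoτ] at h3; omega
  have hσC' : σ ∈ C := by rw [← hσC]; exact Subgroup.mem_zpowers σ
  -- `⟨σ, τ⟩ = G`
  have htop : Subgroup.closure ({σ, τ} : Set G) = ⊤ := by
    set S := Subgroup.closure ({σ, τ} : Set G) with hS
    have hCS : C ≤ S := by
      rw [← hσC, Subgroup.zpowers_le]; exact Subgroup.subset_closure (by simp)
    have hτS : τ ∈ S := Subgroup.subset_closure (by simp)
    have hidx : S.index ∣ 2 := hCi ▸ Subgroup.index_dvd_of_le hCS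
    rcases (Nat.dvd_prime Nat.prime_two).mp hidx with h1 | h2
    · exact Subgroup.index_eq_one.mp h1
    · exfalso
      have hcard : Nat.card S = Nat.card C := by
        have a := S.card_mul_index; have b := C.card_mul_index
        rw [h2] at a; rw [hCi] at b; omega
      have hSC : S = C := (Subgroup.eq_of_le_of_card_ge hCS hcard.le).symm
      exact hτC (hSC ▸ hτS)
  -- `τ σ τ⁻¹ ∈ C = {1, σ, σ²}`
  have hconj : τ * σ * τ⁻¹ ∈ C := by
    have h1 : ¬ (σ * τ⁻¹ ∈ C) := by
      rw [Subgroup.mul_mem_iff_of_index_two hCi]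
      intro h
      exact hτC ((inv_mem_iff (x := τ)).mp (h.mp hσC'))
    rw [mul_assoc, Subgroup.mul_mem_iff_of_index_two hCi]
    exact ⟨fun h ↦ absurd h hτC, fun h ↦ absurd h h1⟩
  rw [← hσC, mem_zpowers_iff_mem_range_orderOf, Finset.mem_image] at hconj
  obtain ⟨i, hi, hconj⟩ := hconj
  rw [Finset.mem_range, hoσ] at hi
  interval_cases i
  · -- `τστ⁻¹ = 1`: absurd
    exfalso
    rw [pow_zero] at hconj
    have h' : τ * σ = τ := mul_inv_eq_one.mp hconj.symm
    have : σ = 1 := mul_left_cancel (h'.trans (mul_one τ).symm)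
    rw [this, orderOf_one] at hoσ
    omega
  · -- `τστ⁻¹ = σ`: then `G` centralises `τ` and `H ⊴ G`
    exfalso
    rw [pow_one] at hconj
    have hc : τ * σ = σ * τ := mul_inv_eq_iff_eq_mul.mp hconj.symm
    have hcent : Subgroup.closure ({σ, τ} : Set G) ≤ Subgroup.centralizer ({τ} : Set G) := by
      rw [Subgroup.closure_le]
      intro g hg
      rw [SetLike.mem_coe, Subgroup.mem_centralizer_iff]
      intro h hh
      rw [Set.mem_singleton_iff] at hh
      subst hh
      rcases hg with rfl | hg
      · exact hc
      · rw [Set.mem_singleton_iff] at hg; subst hg; rfl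
    rw [htop] at hcent
    apply hHn
    refine ⟨fun n hn g ↦ ?_⟩
    rw [← hτH] at hn ⊢
    obtain ⟨m, rfl⟩ := Subgroup.mem_zpowers_iff.mp hn
    have hgτ : τ * g = g * τ := (Subgroup.mem_centralizer_iff.mp (hcent (Subgroup.mem_top g))) τ (Set.mem_singleton τ)
    have hcg : Commute g τ := hgτ.symm
    rw [(hcg.zpow_right m).eq, mul_inv_cancel_right]
    exact Subgroup.zpow_mem _ (Subgroup.mem_zpowers τ) m
  · -- `τστ⁻¹ = σ²`
    exact ⟨σ, τ, hσC, hτH, hσ3, hτ2, mul_inv_eq_iff_eq_mul.mp hconj.symm, htop⟩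

/-- **The `S₃`-pair of a Galois closure of a non-Galois cubic field.**  `L/ℚ` Galois of degree `6`, `F` a cubic number field which is NOT
Galois over `ℚ`, `ι : F →ₐ[ℚ] L`, `k ≤ L` a quadratic subfield.  Then there are `σ, τ ∈ Gal(L/ℚ)` with `σ³ = 1`, `τ² = 1`, `τσ = σ²τ`,
`L^{⟨σ⟩} = k`, `L^{⟨τ⟩} = ι(F)` and `L^{⟨σ,τ⟩} = ℚ` (`Gal(L/ℚ) ≅ S₃`: the subgroup `Gal(L/ι(F))` of order `2` is not normal, since its
fixed field `ι(F) ≅ F` is not Galois over `ℚ`) — the Galois closure of a non-cyclic cubic field is an `S₃`-sextic whose subfields are the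
resolvent (fixed by `A₃ = ⟨σ⟩`) and the three conjugate cubics (fixed by the transpositions). [cite: MilneFT2022, Ch. 3 (fundamental theorem of Galois theory) and Ch. 4 (Galois group of a cubic: A₃ or S₃)]
[cite: DavenportHeilbronn1971, §6 (K₆ = K₃(√d) normal over ℚ with group S₃)] -/
theorem exists_symmetricThree_pair_of_cubic (L : Type) [Field L] [NumberField L] [IsGalois ℚ L] (hL : Module.finrank ℚ L = 6)
    {F : Type} [Field F] [NumberField F] (hF : Module.finrank ℚ F = 3) (hFG : ¬ IsGalois ℚ F) (ι : F →ₐ[ℚ] L)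
    (k : IntermediateField ℚ L) (hk : Module.finrank ℚ ↥k = 2) :
    ∃ σ τ : L ≃ₐ[ℚ] L, σ ^ 3 = 1 ∧ τ ^ 2 = 1 ∧ τ * σ = σ ^ 2 * τ ∧
      fixedField (Subgroup.zpowers σ) = k ∧ fixedField (Subgroup.zpowers τ) = ι.fieldRange ∧
      fixedField (Subgroup.closure ({σ, τ} : Set (L ≃ₐ[ℚ] L))) = ⊥ := by
  have hG : Nat.card (L ≃ₐ[ℚ] L) = 6 := by rw [IsGalois.card_aut_eq_finrank, hL]
  have hC : Nat.card k.fixingSubgroup = 3 := by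
    rw [IsGalois.card_fixingSubgroup_eq_finrank]
    have h := Module.finrank_mul_finrank ℚ ↥k L
    rw [hk, hL] at h
    omega
  have hKF : Module.finrank ℚ ↥ι.fieldRange = 3 := by
    rw [← hF]
    exact (LinearEquiv.finrank_eq (AlgEquiv.ofInjectiveField ι).toLinearEquiv).symm
  have hH : Nat.card ι.fieldRange.fixingSubgroup = 2 := by
    rw [IsGalois.card_fixingSubgroup_eq_finrank]
    have h := Module.finrank_mul_finrank ℚ ↥ι.fieldRange L
    rw [hKF, hL] at h
    omega
  have hHn : ¬ ι.fieldRange.fixingSubgroup.Normal := by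
    intro hn
    haveI := hn
    haveI : IsGalois ℚ ↥(fixedField ι.fieldRange.fixingSubgroup) := IsGalois.of_fixedField_normal_subgroup _
    have e : F ≃ₐ[ℚ] ↥(fixedField ι.fieldRange.fixingSubgroup) :=
      (AlgEquiv.ofInjectiveField ι).trans (IntermediateField.equivOfEq (IsGalois.fixedField_fixingSubgroup ι.fieldRange).symm)
    exact hFG (IsGalois.of_algEquiv e.symm)
  obtain ⟨σ, τ, hσC, hτH, hσ3, hτ2, hτσ, htop⟩ := exists_symmetricThree_pair_of_not_normal hG _ _ hC hH hHn
  refine ⟨σ, τ, hσ3, hτ2, hτσ, ?_, ?_, ?_⟩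
  · rw [hσC, IsGalois.fixedField_fixingSubgroup]
  · rw [hτH, IsGalois.fixedField_fixingSubgroup]
  · rw [htop, IsGalois.fixedField_top]

/-- A Galois sextic number field has a quadratic subfield (the fixed field of an element of order `3`, Cauchy; for the Galois closure of a
non-cyclic cubic field it is the quadratic resolvent `ℚ(√d_F)`). [cite: MilneFT2022, Ch. 3 (fundamental theorem of Galois theory)]
[cite: DavenportHeilbronn1971, §6 (K₂ = ℚ(√d) ⊂ K₆)] -/
theorem exists_intermediateField_finrank_eq_two (L : Type) [Field L] [NumberField L] [IsGalois ℚ L] (hL : Module.finrank ℚ L = 6) :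
    ∃ k : IntermediateField ℚ L, Module.finrank ℚ ↥k = 2 := by
  haveI : Fact (Nat.Prime 3) := ⟨Nat.prime_three⟩
  have hG : Nat.card (L ≃ₐ[ℚ] L) = 6 := by rw [IsGalois.card_aut_eq_finrank, hL]
  obtain ⟨σ, hσ⟩ := exists_prime_orderOf_dvd_card' (G := L ≃ₐ[ℚ] L) 3 (by rw [hG]; norm_num)
  refine ⟨fixedField (Subgroup.zpowers σ), ?_⟩
  have h1 : Nat.card (fixedField (Subgroup.zpowers σ)).fixingSubgroup = 3 := by
    rw [IntermediateField.fixingSubgroup_fixedField, Nat.card_zpowers, hσ]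
  rw [IsGalois.card_fixingSubgroup_eq_finrank] at h1
  have h := Module.finrank_mul_finrank ℚ ↥(fixedField (Subgroup.zpowers σ)) L
  rw [h1, hL] at h
  omega

/-! ### §2 The exact relation `e_n(L) = e_n(k) + 2·e_n(F)` in the intrinsic cyclotomic currency -/

/-- `√2 ∉ L` descends along a `ℚ`-algebra map `F → L`. [folklore] -/
private theorem forall_sq_ne_two_of_algHom {F L : Type} [Field F] [Field L] [Algebra ℚ F] [Algebra ℚ L] (ι : F →ₐ[ℚ] L)
    (h2 : ∀ x : L, x ^ 2 ≠ 2) : ∀ x : F, x ^ 2 ≠ 2 := fun x hx ↦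
  h2 (ι x) (by rw [← map_pow, hx, map_ofNat])

/-- ★★ **THE EXACT `S₃` RELATION FOR A CUBIC FIELD, ITS GALOIS CLOSURE AND ITS RESOLVENT, at every layer of the cyclotomic `ℤ₂`-towers.**
`F` a cubic number field, not Galois over `ℚ`; `L/ℚ` Galois of degree `6` with `ι : F →ₐ[ℚ] L` and `√2 ∉ L`; `k ≤ L` quadratic; `κ_L, κ_k, κ_F`
ANY cyclotomic `ℤ₂`-extensions of `L`, `k`, `F`.  Then for every `n`:  **`e_n(κ_L) = e_n(κ_k) + 2·e_n(κ_F)`**, i.e.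
`ord₂ h(L·ℚ_n) = ord₂ h(k·ℚ_n) + 2·ord₂ h(F·ℚ_n)` — the `2`-part of the Brauer–Kuroda relation for the `S₃`-extensions `L·ℚ_n/ℚ_n`
(Walter; Caputo–Nuccio Prop. 3.12), `h(ℚ_n)` odd (Weber).  No `μ`, parity or class-number hypothesis.
[cite: CaputoNuccio2020, Prop. 3.12] [cite: Bartel2012, Cor. 5.2] [cite: Washington1997, §13.1 and Thm. 10.4] -/
theorem classNumberPExp_galoisClosure_eq_resolvent_add_two_mul_cubic
    {F : Type} [Field F] [NumberField F] (hF : Module.finrank ℚ F = 3) (hFG : ¬ IsGalois ℚ F)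
    (L : Type) [Field L] [NumberField L] [IsGalois ℚ L] (hL : Module.finrank ℚ L = 6) (ι : F →ₐ[ℚ] L)
    (h2 : ∀ x : L, x ^ 2 ≠ 2) (k : IntermediateField ℚ L) (hk : Module.finrank ℚ ↥k = 2)
    (κL : ZpExtension L 2) (hκL : κL.IsCyclotomic) (κk : ZpExtension ↥k 2) (hκk : κk.IsCyclotomic)
    (κF : ZpExtension F 2) (hκF : κF.IsCyclotomic) (n : ℕ) :
    classNumberPExp κL n = classNumberPExp κk n + 2 * classNumberPExp κF n := by
  haveI : ∀ E : IntermediateField ℚ L, NumberField ↥E := fun E ↦ NumberField.mk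
  obtain ⟨κ, hκ⟩ := exists_cyclotomicZpExtension_holds ℚ 2
  have hLs := surjective_comp_absGaloisRestrict_of_forall_sq_ne_two' κ L hκ h2
  obtain ⟨σ, τ, hσ3, hτ2, hτσ, hσk, hτF, hbot⟩ := exists_symmetricThree_pair_of_cubic L hL hF hFG ι k hk
  have hR := surjective_comp_absGaloisRestrict_of_tower κ ↥(fixedField (Subgroup.zpowers σ)) L hLs
  have hK := surjective_comp_absGaloisRestrict_of_tower κ ↥(fixedField (Subgroup.zpowers τ)) L hLs
  have hb := surjective_comp_absGaloisRestrict_of_tower κ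
    ↥(fixedField (Subgroup.closure ({σ, τ} : Set (L ≃ₐ[ℚ] L)))) L hLs
  have hks := surjective_comp_absGaloisRestrict_of_tower κ ↥k L hLs
  have hFs := surjective_comp_absGaloisRestrict_of_forall_sq_ne_two' κ F hκ (forall_sq_ne_two_of_algHom ι h2)
  have hQs : Function.Surjective (κ.toContinuousMonoidHom.comp (absGaloisRestrict ℚ ℚ)) :=
    surjective_comp_absGaloisRestrict_of_not_dvd_finrank κ ℚ (by rw [Module.finrank_self]; decide)
  -- the three fixed fields, identified with `k`, `F`, `ℚ`
  have φk : ↥(fixedField (Subgroup.zpowers σ)) ≃ₐ[ℚ] ↥k := IntermediateField.equivOfEq hσk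
  have φF : ↥(fixedField (Subgroup.zpowers τ)) ≃ₐ[ℚ] F :=
    (IntermediateField.equivOfEq hτF).trans (AlgEquiv.ofInjectiveField ι).symm
  have φ0 : ↥(fixedField (Subgroup.closure ({σ, τ} : Set (L ≃ₐ[ℚ] L)))) ≃ₐ[ℚ] ℚ :=
    (IntermediateField.equivOfEq hbot).trans (IntermediateField.botEquiv ℚ L)
  -- the exact relation along `κ` (restated in this context), then transport to the given towers
  have main : classNumberPExp (κ.restrict L hLs) n +
      2 * classNumberPExp (κ.restrict ↥(fixedField (Subgroup.closure ({σ, τ} : Set (L ≃ₐ[ℚ] L)))) hb) n =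
      classNumberPExp (κ.restrict ↥(fixedField (Subgroup.zpowers σ)) hR) n +
        2 * classNumberPExp (κ.restrict ↥(fixedField (Subgroup.zpowers τ)) hK) n :=
    classNumberPExp_symmetricThree_exact κ L hLs hσ3 hτ2 hτσ hR hK hb n
  have e0 : classNumberPExp (κ.restrict ↥(fixedField (Subgroup.closure ({σ, τ} : Set (L ≃ₐ[ℚ] L)))) hb) n = 0 := by
    rw [classNumberPExp_restrict_eq_of_algEquiv κ φ0 hb hQs n]
    exact classNumberPExp_rat_eq_zero _ n
  have eL : classNumberPExp κL n = classNumberPExp (κ.restrict L hLs) n :=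
    classNumberPExp_eq_of_isCyclotomic κL _ hκL (isCyclotomic_restrict κ hκ _ hLs) n
  have ek : classNumberPExp κk n = classNumberPExp (κ.restrict ↥(fixedField (Subgroup.zpowers σ)) hR) n := by
    rw [classNumberPExp_restrict_eq_of_algEquiv κ φk hR hks n]
    exact classNumberPExp_eq_of_isCyclotomic κk _ hκk (isCyclotomic_restrict κ hκ _ hks) n
  have eF : classNumberPExp κF n = classNumberPExp (κ.restrict ↥(fixedField (Subgroup.zpowers τ)) hK) n := by
    rw [classNumberPExp_restrict_eq_of_algEquiv κ φF hK hFs n]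
    exact classNumberPExp_eq_of_isCyclotomic κF _ hκF (isCyclotomic_restrict κ hκ _ hFs) n
  omega

/-! ### §3 Iwasawa invariants: `μ₂(L) = 0 ⟺ μ₂(F) = 0` and `λ₂(L) = λ₂(k) + 2λ₂(F)` -/

/-- `μ = 0` (growth form) depends only on the sequence `e_n`. [folklore] -/
private theorem classicalMuVanishes_iff_of_forall_eq {K₁ K₂ : Type} [Field K₁] [Field K₂] (κ₁ : ZpExtension K₁ 2) (κ₂ : ZpExtension K₂ 2)
    (h : ∀ n, classNumberPExp κ₁ n = classNumberPExp κ₂ n) : ClassicalMuVanishes κ₁ ↔ ClassicalMuVanishes κ₂ := by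
  simp only [ClassicalMuVanishes, h]

/-- `λ` (growth form) depends only on the sequence `e_n`. [folklore] -/
private theorem classicalLambda_eq_of_forall_eq {K₁ K₂ : Type} [Field K₁] [Field K₂] (κ₁ : ZpExtension K₁ 2) (κ₂ : ZpExtension K₂ 2)
    (h : ∀ n, classNumberPExp κ₁ n = classNumberPExp κ₂ n) : classicalLambda κ₁ = classicalLambda κ₂ := by
  by_cases hμ : ClassicalMuVanishes κ₁
  · obtain ⟨ν, n₀, hν⟩ := classicalLambda_spec κ₁ hμ
    exact eq_classicalLambda_of_growth κ₂ (ν := ν) (n₀ := n₀) fun n hn ↦ by rw [← h n]; exact hν n hn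
  · have hμ' : ¬ ClassicalMuVanishes κ₂ := fun h' ↦ hμ ((classicalMuVanishes_iff_of_forall_eq κ₁ κ₂ h).mpr h')
    rw [classicalLambda_eq_zero_of_not_classicalMuVanishes κ₁ hμ, classicalLambda_eq_zero_of_not_classicalMuVanishes κ₂ hμ']


/-- **Halving a growth law** (arithmetic helper): if `2·e_n = a·n + b` for all `n ≥ N` (`a, b ∈ ℤ`), then `e_n = l·n + ν` eventually with
`l ∈ ℕ` — `a = 2(e_{N+1} − e_N)` is even and `≥ 0` since `e_n ≥ 0`. [folklore] -/
private theorem classicalMuVanishes_of_two_mul_eq_linear' {K' : Type} [Field K'] (κ' : ZpExtension K' 2) {a b : ℤ} {N : ℕ}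
    (h : ∀ n, N ≤ n → 2 * (classNumberPExp κ' n : ℤ) = a * n + b) : ClassicalMuVanishes κ' := by
  have hN := h N le_rfl
  have hN1 := h (N + 1) (Nat.le_succ N)
  set l : ℤ := (classNumberPExp κ' (N + 1) : ℤ) - classNumberPExp κ' N with hl
  have ha : a = 2 * l := by push_cast at hN1; linarith
  have hl0 : 0 ≤ l := by
    by_contra hlt'
    have hlt : l ≤ -1 := by omega
    have hC := h (N + (Int.toNat b + 1)) (Nat.le_add_right _ _)
    have hnn : (0 : ℤ) ≤ classNumberPExp κ' (N + (Int.toNat b + 1)) := by positivity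
    have ht : b ≤ (Int.toNat b : ℤ) := Int.self_le_toNat _
    push_cast at hC
    nlinarith
  refine ⟨l.toNat, (classNumberPExp κ' N : ℤ) - l * N, N, fun n hn => ?_⟩
  have hn' := h n hn
  rw [Int.toNat_of_nonneg hl0]
  rw [ha] at hN hn'
  have : 2 * (classNumberPExp κ' n : ℤ) = 2 * (l * n + ((classNumberPExp κ' N : ℤ) - l * N)) := by
    rw [hn']; linarith
  linarith

/-- ★ **`μ₂ = 0` FOR THE GALOIS CLOSURE ⟺ `μ₂ = 0` FOR THE CUBIC FIELD** (growth form, cyclotomic `ℤ₂`-extensions; `F` cubic not Galois over `ℚ`,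
`L ⊇ ι(F)` Galois sextic with `√2 ∉ L`).  The resolvent input `μ₂(k) = 0` is a THEOREM for every quadratic field
(`classicalMuVanishes_of_finrank_eq_two`) and `e_n(ℚ) = 0` (Weber), so the square of `SymmetricThreeTowerExact` §3 closes with no hypothesis:
by the exact relation, `e_n(L) − 2e_n(F) = e_n(k)` is eventually linear.  In particular Iwasawa's `μ₂`-conjecture for `S₃`-sextics and for
`S₃`-cubics is ONE statement. [cite: CaputoNuccio2020, Prop. 3.12] [cite: Washington1997, §13.3 Thm. 13.13] [cite: FerreroWashington1979, Thm.] -/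
theorem classicalMuVanishes_galoisClosure_iff_cubic
    {F : Type} [Field F] [NumberField F] (hF : Module.finrank ℚ F = 3) (hFG : ¬ IsGalois ℚ F)
    (L : Type) [Field L] [NumberField L] [IsGalois ℚ L] (hL : Module.finrank ℚ L = 6) (ι : F →ₐ[ℚ] L)
    (h2 : ∀ x : L, x ^ 2 ≠ 2)
    (κL : ZpExtension L 2) (hκL : κL.IsCyclotomic) (κF : ZpExtension F 2) (hκF : κF.IsCyclotomic) :
    ClassicalMuVanishes κL ↔ ClassicalMuVanishes κF := by
  haveI : ∀ E : IntermediateField ℚ L, NumberField ↥E := fun E ↦ NumberField.mk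
  obtain ⟨k, hk⟩ := exists_intermediateField_finrank_eq_two L hL
  obtain ⟨κk, hκk⟩ := exists_cyclotomicZpExtension_holds ↥k 2
  have he : ∀ n, classNumberPExp κL n = classNumberPExp κk n + 2 * classNumberPExp κF n := fun n ↦
    classNumberPExp_galoisClosure_eq_resolvent_add_two_mul_cubic hF hFG L hL ι h2 k hk κL hκL κk hκk κF hκF n
  obtain ⟨lk, νk, nk, hgk⟩ := classicalMuVanishes_of_finrank_eq_two ↥k hk κk hκk
  constructor
  · rintro ⟨lL, νL, nL, hgL⟩
    refine classicalMuVanishes_of_two_mul_eq_linear' κF (a := lL - lk) (b := νL - νk) (N := max nL nk) fun n hn ↦ ?_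
    have h1 := hgL n ((le_max_left _ _).trans hn)
    have h2' := hgk n ((le_max_right _ _).trans hn)
    have h3 : (classNumberPExp κL n : ℤ) = classNumberPExp κk n + 2 * classNumberPExp κF n := by exact_mod_cast he n
    rw [h1, h2'] at h3
    linarith
  · rintro ⟨lF, νF, nF, hgF⟩
    refine ⟨lk + 2 * lF, νk + 2 * νF, max nk nF, fun n hn ↦ ?_⟩
    have h1 := hgk n ((le_max_left _ _).trans hn)
    have h2' := hgF n ((le_max_right _ _).trans hn)
    have h3 : (classNumberPExp κL n : ℤ) = classNumberPExp κk n + 2 * classNumberPExp κF n := by exact_mod_cast he n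
    rw [h3, h1, h2']
    push_cast
    ring

/-- ★ **`λ₂(L) = λ₂(k) + 2·λ₂(F)`** for the cyclotomic `ℤ₂`-extensions of a non-Galois cubic field `F`, a Galois closure `L ⊇ ι(F)` with
`√2 ∉ L`, and a quadratic subfield `k ≤ L`, given `μ₂(F) = 0` (growth form; then `μ₂(L) = μ₂(k) = 0` as well).  With the tree's closed forms
for `λ₂` of quadratic fields (Ferrero, Kida; att-p3 g31–g32) this prices `λ₂` of every `S₃`-sextic by the cubic's.
[cite: CaputoNuccio2020, Prop. 3.12] [cite: Washington1997, §13.3 Thm. 13.13] -/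
theorem classicalLambda_galoisClosure_eq_resolvent_add_two_mul_cubic
    {F : Type} [Field F] [NumberField F] (hF : Module.finrank ℚ F = 3) (hFG : ¬ IsGalois ℚ F)
    (L : Type) [Field L] [NumberField L] [IsGalois ℚ L] (hL : Module.finrank ℚ L = 6) (ι : F →ₐ[ℚ] L)
    (h2 : ∀ x : L, x ^ 2 ≠ 2) (k : IntermediateField ℚ L) (hk : Module.finrank ℚ ↥k = 2)
    (κL : ZpExtension L 2) (hκL : κL.IsCyclotomic) (κk : ZpExtension ↥k 2) (hκk : κk.IsCyclotomic)
    (κF : ZpExtension F 2) (hκF : κF.IsCyclotomic) (hμF : ClassicalMuVanishes κF) :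
    classicalLambda κL = classicalLambda κk + 2 * classicalLambda κF := by
  haveI : ∀ E : IntermediateField ℚ L, NumberField ↥E := fun E ↦ NumberField.mk
  have he : ∀ n, classNumberPExp κL n = classNumberPExp κk n + 2 * classNumberPExp κF n := fun n ↦
    classNumberPExp_galoisClosure_eq_resolvent_add_two_mul_cubic hF hFG L hL ι h2 k hk κL hκL κk hκk κF hκF n
  have hμk := classicalMuVanishes_of_finrank_eq_two ↥k hk κk hκk
  obtain ⟨νk, nk, hgk⟩ := classicalLambda_spec κk hμk
  obtain ⟨νF, nF, hgF⟩ := classicalLambda_spec κF hμF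
  refine (eq_classicalLambda_of_growth κL (ν := νk + 2 * νF) (n₀ := max nk nF) fun n hn ↦ ?_).symm
  have h1 := hgk n ((le_max_left _ _).trans hn)
  have h2' := hgF n ((le_max_right _ _).trans hn)
  have h3 : (classNumberPExp κL n : ℤ) = classNumberPExp κk n + 2 * classNumberPExp κF n := by exact_mod_cast he n
  rw [h3, h1, h2']
  push_cast
  ring

/-! ### §4 The same with `[Algebra F L]` -/

/-- `e_n(L) = e_n(k) + 2·e_n(F)` for `F ⊆ L` given as an algebra tower (`[Algebra F L]`). [cite: CaputoNuccio2020, Prop. 3.12]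
[cite: Washington1997, §13.1] -/
theorem classNumberPExp_galoisClosure_eq_resolvent_add_two_mul_cubic'
    {F : Type} [Field F] [NumberField F] (hF : Module.finrank ℚ F = 3) (hFG : ¬ IsGalois ℚ F)
    (L : Type) [Field L] [NumberField L] [Algebra F L] [IsGalois ℚ L] (hL : Module.finrank ℚ L = 6)
    (h2 : ∀ x : L, x ^ 2 ≠ 2) (k : IntermediateField ℚ L) (hk : Module.finrank ℚ ↥k = 2)
    (κL : ZpExtension L 2) (hκL : κL.IsCyclotomic) (κk : ZpExtension ↥k 2) (hκk : κk.IsCyclotomic)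
    (κF : ZpExtension F 2) (hκF : κF.IsCyclotomic) (n : ℕ) :
    classNumberPExp κL n = classNumberPExp κk n + 2 * classNumberPExp κF n :=
  classNumberPExp_galoisClosure_eq_resolvent_add_two_mul_cubic hF hFG L hL (IsScalarTower.toAlgHom ℚ F L) h2 k hk κL hκL κk hκk κF hκF n

/-- `μ₂(L) = 0 ⟺ μ₂(F) = 0` for `F ⊆ L` given as an algebra tower. [cite: CaputoNuccio2020, Prop. 3.12] [cite: Washington1997, §13.3 Thm. 13.13] -/
theorem classicalMuVanishes_galoisClosure_iff_cubic'
    {F : Type} [Field F] [NumberField F] (hF : Module.finrank ℚ F = 3) (hFG : ¬ IsGalois ℚ F)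
    (L : Type) [Field L] [NumberField L] [Algebra F L] [IsGalois ℚ L] (hL : Module.finrank ℚ L = 6)
    (h2 : ∀ x : L, x ^ 2 ≠ 2)
    (κL : ZpExtension L 2) (hκL : κL.IsCyclotomic) (κF : ZpExtension F 2) (hκF : κF.IsCyclotomic) :
    ClassicalMuVanishes κL ↔ ClassicalMuVanishes κF :=
  classicalMuVanishes_galoisClosure_iff_cubic hF hFG L hL (IsScalarTower.toAlgHom ℚ F L) h2 κL hκL κF hκF

/-- **The input form**: «`μ₂ = 0` for every cyclotomic `ℤ₂`-extension of the Galois closure `L`» ⟺ «the same for the cubic `F`».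
[cite: CaputoNuccio2020, Prop. 3.12] [cite: Washington1997, §13.3 Thm. 13.13] -/
theorem forall_classicalMuVanishes_galoisClosure_iff_cubic
    {F : Type} [Field F] [NumberField F] (hF : Module.finrank ℚ F = 3) (hFG : ¬ IsGalois ℚ F)
    (L : Type) [Field L] [NumberField L] [Algebra F L] [IsGalois ℚ L] (hL : Module.finrank ℚ L = 6)
    (h2 : ∀ x : L, x ^ 2 ≠ 2) :
    (∀ κL : ZpExtension L 2, κL.IsCyclotomic → ClassicalMuVanishes κL) ↔
      ∀ κF : ZpExtension F 2, κF.IsCyclotomic → ClassicalMuVanishes κF := by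
  obtain ⟨κ₁, hκ₁⟩ := exists_cyclotomicZpExtension_holds L 2
  obtain ⟨κ₂, hκ₂⟩ := exists_cyclotomicZpExtension_holds F 2
  exact ⟨fun h κF hκF ↦ (classicalMuVanishes_galoisClosure_iff_cubic' hF hFG L hL h2 κ₁ hκ₁ κF hκF).mp (h κ₁ hκ₁),
    fun h κL hκL ↦ (classicalMuVanishes_galoisClosure_iff_cubic' hF hFG L hL h2 κL hκL κ₂ hκ₂).mpr (h κ₂ hκ₂)⟩

end Literature.NumberTheory.IwasawaTheory

end
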